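import Literature.AnabelianGeometry.EtaleTheta.Discharge.Sec2Cor218iAtModelTateNonInnerModFour
import HarnessLib

/-!
# [EtTh] Thm. 1.6 (i) / Cor. 2.18 (i) (F-0620) at the stage-2 Tate model `ThetaSetting.modelχq p i 2`, the PRIME `p = 2`:
# the mod-`2` Kummer class of `2` is a function of the mod-`8` cyclotomic character, hence is preserved by every
# `χ`-compatible automorphism of `G_{ℚ_2}` (proof-only; K-L6 row «THM16I-ODDPARITY-Γ@p≡3(4)», the `p = 2` slice)

S. Mochizuki, *The étale theta function and its Frobenioid-theoretic manifestations* [EtTh], Publ. RIMS **45** (2009):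
Thm. 1.6 (i), PRIMS PDF p. 24 («`γ(Π^tp_{Ÿα}) = Π^tp_{Ÿβ}`») [cite: MochizukiEtTh2009, Thm 1.6 (i) p.24]; Cor. 2.18 (i)
p. 60 (FACT-LIST F-0620 `RigidData.Cor218_i`) [cite: MochizukiEtTh2009, Cor 2.18(i) p.60]; §1 p. 13 (`K_N := K(ζ_N, q_X^{1/N})`,
the Galois action on `(Δ^tp_X)^ell`: cyclotomic character on `Ẑ(1)·b`, Kummer cocycle of the `q`-parameter in the corner)
[cite: MochizukiEtTh2009, §1 p.13]; J. Neukirch, *Algebraic Number Theory*, Ch. IV §3 (Kummer theory), Ch. I §10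
(`√2 = ζ₈ + ζ₈⁻¹ ∈ ℚ(ζ₈)`) [cite: NeukirchANT1999, Ch. IV §3].

abc-iut cell, layer L6 / K-L6 instance column, seat abc-iut-w6-d116 (gen 5), BY-NAME support slice of the row
«THM16I-ODDPARITY-Γ@p≡3(4)» (holders: abc-iut-w4-d038 g11 FILE B `χ ∘ ν = χ`, abc-iut-w6-d051 g5 FILE A Gauss sums for
odd `p`); this file is the `p = 2` case that neither covers. PROOF-ONLY: no definition, no instance, no `Prop`-valued
fact; inputs BY NAME (abc-iut-w5-d091 `apply_eq_pow_levelChar_chi` / `exists_isPrimitiveRoot_padicAlgCl`; abc-iut-L2-t5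
`apply_pRoot` / `pRoot_pow` / `pRoot_ne_zero` / `isPrimitiveRoot_coe_cycGen`; abc-iut-L6-d6 gen 5/6
`exists_restrict_of_map_deltaTemp_eq` / `map_deltaTempχq_symm_eq` / `apply_mem_GtpYdd_of_level_two_eq` /
`right_apply_inr_right_symm_apply_inr` / `levelHom_two_y_eq_zero_of_map_GtpYdd_le`; abc-iut-L2-d1
`rigidData_cor218_i_of_extends`).

THE QUESTION (abc-iut-L6-d6 gen 6 memo `THM16I-NONINNER-AT-MODELTATE.md`, item (iii)): at `p ≢ 1 (mod 4)`, `i` odd, gen 6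
proved `Γ(Π^tp_Ÿ) = Π^tp_Ÿ ⟺ the b-exponent of Γ(a) is EVEN` (`map_GtpYdd_eq_iff_levelHom_two_y_eq_zero`) and reduced
the existence of an odd `Γ` to an `Aut(G_{ℚ_p})` question: a `χ`-preserving `ν` with `κ_p ∘ ν ≢ κ_p (mod 2)`. For
`p = 2` the answer is NO, for the elementary reason recorded here: `√2 = ζ₈ + ζ₈⁻¹` lies in `ℚ_2(ζ₈)`, so the quadratic
Kummer character of `2` FACTORS THROUGH `χ mod 8`.

WHAT THIS FILE PROVES (numbers, not adjectives).
§1 (every `p`) `level_two_kappaP_eq_of_apply_eq_of_sq_eq` — if `s² = p` in `ℚ̄_p` and `σ s = τ s`, then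
   `level 2 (κ_p σ) = level 2 (κ_p τ)` (`s = ±p^{1/2}`, `σ(p^{1/2}) = ξ₂^{κ₂(σ)}·p^{1/2}` with `ξ₂` a primitive square root
   of `1`); `sq_add_inv_eq_two_of_isPrimitiveRoot_eight` — `(ζ + ζ⁻¹)² = 2` for a primitive 8th root of unity `ζ` in any
   field; `apply_add_inv_eq_of_levelChar_chi_eq` — `σ(ζ + ζ⁻¹) = τ(ζ + ζ⁻¹)` for `ζ^N = 1` once `χ_N(σ) = χ_N(τ)`.
§2 (`p = 2`) `level_two_kappaP_eq_of_levelChar_eight_chi_eq` — **`χ₈(σ) = χ₈(τ) ⇒ κ₂(σ) ≡ κ₂(τ) (mod 2)`** (the mod-2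
   Kummer class of `2` is a function of `χ mod 8`); a fortiori `chi p σ = chi p τ ⇒ …` (`…_of_chi_eq`).
§3 (`p = 2`, the model) `map_GtpYdd_eq_of_map_deltaTemp_eq_of_levelChar_eight_chi_eq` — for EVERY `i` and every
   `Δ^tp_X`-stabilising topological automorphism `Γ` of `Π^tp_X(modelχq 2 i 2)` whose induced `ν σ := (Γ (inr σ)).right`
   satisfies `χ₈ ∘ ν = χ₈` (⟸ `χ ∘ ν = χ`, FILE B), **`Γ(Π^tp_Ÿ) = Π^tp_Ÿ`**; hence (odd `i`) the `b`-exponent of `Γ(a)` is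
   EVEN (`levelHom_two_y_eq_zero_of_map_deltaTemp_eq_of_levelChar_eight_chi_eq`) — no odd-parity `Γ` over a
   `χ`-compatible `ν` exists at `p = 2`; and §4 F-0620 `Cor218_i` at `modelχq 2 i 2` from `hextΔ` + the `χ`-compatibility
   of the extensions (`rigidData_cor218_i_modelχq_of_extends_of_chi_comp_eq_of_eq_two`).

HONEST LABEL: `modelχq` is a SEMI-SYNTHETIC model of the typed [EtTh] §1 interface (statement/model-pair evidence);
F-0620 stays a FACT-policy row; the `χ`-compatibility `χ ∘ ν = χ` of a `Δ`-stabilising `Γ` is a HYPOTHESIS here (FILE B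
of the row discharges it); nothing of [EtTh] (refereed) is asserted beyond the tree's proofs; no side is taken on
[IUTchIII] Cor. 3.12; typed ≠ proved; nothing here says abc is proved or refuted.
-/

noncomputable section

namespace Literature.AnabelianGeometry.EtaleTheta

namespace SettingModel

open Literature.AnabelianGeometry.SemiGraphs Function Topology

variable (p : ℕ) [Fact p.Prime] (i : ℤ)

/-! ## §1. Generic: the mod-`2` Kummer class of `p` is read off ANY square root of `p` -/

/-- **`(ζ + ζ⁻¹)² = 2` for a primitive 8th root of unity `ζ`** (in any field): `ζ⁴ = −1`, so
`(ζ + ζ⁻¹)²·ζ² = (ζ² + 1)² = ζ⁴ + 2ζ² + 1 = 2ζ²`. [cite: NeukirchANT1999, Ch. I §10] -/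
theorem sq_add_inv_eq_two_of_isPrimitiveRoot_eight {K : Type*} [Field K] {ζ : K} (hζ : IsPrimitiveRoot ζ 8) :
    (ζ + ζ⁻¹) ^ 2 = 2 := by
  have hζ0 : ζ ≠ 0 := hζ.ne_zero (by norm_num)
  have h4 : ζ ^ 4 = -1 := (hζ.pow (by norm_num) (show 8 = 4 * 2 by norm_num)).eq_neg_one_of_two_right
  have hmul : (ζ + ζ⁻¹) * ζ = ζ ^ 2 + 1 := by
    rw [add_mul, inv_mul_cancel₀ hζ0]; ring
  have h : (ζ + ζ⁻¹) ^ 2 * ζ ^ 2 = 2 * ζ ^ 2 := by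
    calc (ζ + ζ⁻¹) ^ 2 * ζ ^ 2 = ((ζ + ζ⁻¹) * ζ) ^ 2 := by ring
      _ = (ζ ^ 2 + 1) ^ 2 := by rw [hmul]
      _ = ζ ^ 4 + 2 * ζ ^ 2 + 1 := by ring
      _ = 2 * ζ ^ 2 := by rw [h4]; ring
  exact mul_right_cancel₀ (pow_ne_zero 2 hζ0) h

/-- **`σ(ζ + ζ⁻¹) = τ(ζ + ζ⁻¹)` for an `N`-th root of unity `ζ ∈ ℚ̄_p` as soon as `χ_N(σ) = χ_N(τ)`** (both sides are
`ζ^{χ_N} + ζ^{−χ_N}`, abc-iut-w5-d091's `apply_eq_pow_levelChar_chi`). [cite: MochizukiEtTh2009, §1 p.13] -/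
theorem apply_add_inv_eq_of_levelChar_chi_eq {N : ℕ+} {ζ : PadicAlgCl p} (hζ : ζ ^ (N : ℕ) = 1) {σ τ : GQp p}
    (h : ZHatLevel.levelChar N (chi p σ) = ZHatLevel.levelChar N (chi p τ)) :
    σ (ζ + ζ⁻¹) = τ (ζ + ζ⁻¹) := by
  rw [map_add, map_inv₀, map_add, map_inv₀, apply_eq_pow_levelChar_chi p σ N hζ,
    apply_eq_pow_levelChar_chi p τ N hζ, h]

/-- **The mod-`2` Kummer class of `p` is read off any square root of `p`.** If `s² = p` in `ℚ̄_p` and two elements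
`σ, τ ∈ G_{ℚ_p}` agree on `s`, then `κ_p(σ) ≡ κ_p(τ) (mod 2)`: indeed `s = ±p^{1/2}` for the CHOSEN root `p^{1/2}` of
abc-iut-L2-t5's root system, `σ(p^{1/2}) = ξ₂^{κ₂(σ)}·p^{1/2}` (`apply_pRoot`) with `ξ₂` a PRIMITIVE square root of `1`,
and `ξ₂^a = ξ₂^b` with `a, b < 2` forces `a = b`. [cite: NeukirchANT1999, Ch. IV §3] -/
theorem level_two_kappaP_eq_of_apply_eq_of_sq_eq {s : PadicAlgCl p} (hs : s ^ 2 = (p : PadicAlgCl p))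
    {σ τ : GQp p} (h : σ s = τ s) :
    ZHatLevel.level 2 (kappaP p σ) = ZHatLevel.level 2 (kappaP p τ) := by
  haveI : NeZero ((2 : ℕ+) : ℕ) := ⟨(2 : ℕ+).ne_zero⟩
  have hr : pRoot p 2 ^ 2 = (p : PadicAlgCl p) := pRoot_pow p 2
  have hsr : s = pRoot p 2 ∨ s = -pRoot p 2 := by
    rw [← sq_eq_sq_iff_eq_or_eq_neg, hs, hr]
  have hστ : σ (pRoot p 2) = τ (pRoot p 2) := by
    rcases hsr with hs' | hs'
    · rw [← hs']; exact h
    · rw [hs', map_neg, map_neg] at h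
      exact neg_injective h
  rw [apply_pRoot p σ 2, apply_pRoot p τ 2] at hστ
  have hpow := mul_right_cancel₀ (pRoot_ne_zero p 2) hστ
  have hab := (isPrimitiveRoot_coe_cycGen p 2).pow_inj (ZMod.val_lt _) (ZMod.val_lt _) hpow
  exact Multiplicative.toAdd.injective (ZMod.val_injective _ hab)

/-! ## §2. `p = 2`: the mod-`2` Kummer class of `2` is a function of `χ mod 8` -/

/-- **`p = 2`: `χ₈(σ) = χ₈(τ) ⇒ κ₂(σ) ≡ κ₂(τ) (mod 2)`.** With `ζ ∈ ℚ̄_2` a primitive 8th root of unity, `s := ζ + ζ⁻¹`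
satisfies `s² = 2` and `σ s = ζ^{χ₈(σ)} + ζ^{−χ₈(σ)}`, so two elements of `G_{ℚ_2}` with the same `χ mod 8` agree on a square
root of `2`, hence (§1) have the same Kummer class of `2` mod `2`: the quadratic character of `ℚ_2(√2)/ℚ_2` factors
through `Gal(ℚ_2(ζ₈)/ℚ_2)`. [cite: NeukirchANT1999, Ch. IV §3] -/
theorem level_two_kappaP_eq_of_levelChar_eight_chi_eq (hp : p = 2) {σ τ : GQp p}
    (h : ZHatLevel.levelChar 8 (chi p σ) = ZHatLevel.levelChar 8 (chi p τ)) :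
    ZHatLevel.level 2 (kappaP p σ) = ZHatLevel.level 2 (kappaP p τ) := by
  subst hp
  obtain ⟨ζ, hζ⟩ := exists_isPrimitiveRoot_padicAlgCl 2 8 (by norm_num)
  have hs : (ζ + ζ⁻¹) ^ 2 = ((2 : ℕ) : PadicAlgCl 2) := by
    rw [Nat.cast_ofNat]; exact sq_add_inv_eq_two_of_isPrimitiveRoot_eight hζ
  have hζ8 : ζ ^ ((8 : ℕ+) : ℕ) = 1 := hζ.pow_eq_one
  exact level_two_kappaP_eq_of_apply_eq_of_sq_eq 2 hs (apply_add_inv_eq_of_levelChar_chi_eq 2 hζ8 h)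

/-- **`p = 2`: `χ(σ) = χ(τ) ⇒ κ₂(σ) ≡ κ₂(τ) (mod 2)`** (the hypothesis shape of a `χ`-compatible automorphism `ν` of
`G_{ℚ_2}`, `χ ∘ ν = χ`, at `τ := ν σ`). [cite: NeukirchANT1999, Ch. IV §3] -/
theorem level_two_kappaP_eq_of_chi_eq_of_eq_two (hp : p = 2) {σ τ : GQp p} (h : chi p σ = chi p τ) :
    ZHatLevel.level 2 (kappaP p σ) = ZHatLevel.level 2 (kappaP p τ) :=
  level_two_kappaP_eq_of_levelChar_eight_chi_eq p hp (by rw [h])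

/-! ## §3. Thm. 1.6 (i) at `modelχq 2 i 2` over `χ`-compatible automorphisms of `G_{ℚ_2}` -/

/-- `χ₈`-compatibility of `Γ` passes to `Γ⁻¹` (`ν` is onto: abc-iut-L6-d6's `right_apply_inr_right_symm_apply_inr`).
[cite: MochizukiEtTh2009, §1 p.12] -/
theorem levelChar_chi_right_symm_apply_inr_eq {N : ℕ+} (Γ : PiTpχq p i 2 ≃ₜ* PiTpχq p i 2)
    (hΔ : (curveχq p i 2).DeltaTemp.map Γ.toMulEquiv.toMonoidHom = (curveχq p i 2).DeltaTemp)
    (hχ : ∀ σ : GQp p, ZHatLevel.levelChar N (chi p (Γ (SemidirectProduct.inr σ)).right) =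
      ZHatLevel.levelChar N (chi p σ)) (τ : GQp p) :
    ZHatLevel.levelChar N (chi p (Γ.symm (SemidirectProduct.inr τ)).right) = ZHatLevel.levelChar N (chi p τ) := by
  obtain ⟨φ, hφ⟩ := exists_restrict_of_map_deltaTemp_eq p i Γ hΔ
  have h := hχ (Γ.symm (SemidirectProduct.inr τ)).right
  rw [right_apply_inr_right_symm_apply_inr p i Γ φ hφ τ] at h
  exact h.symm

/-- **`p = 2`: every `Δ^tp_X`-stabilising topological automorphism `Γ` of `Π^tp_X(modelχq 2 i 2)` whose induced
automorphism `ν σ := (Γ (inr σ)).right` of `G_{ℚ_2}` preserves `χ mod 8` maps `Π^tp_Ÿ` ONTO itself — EVERY `i`.** The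
level-`2` input `κ₂(σ)^i = κ₂(ν σ)^i` of abc-iut-L6-d6's `apply_mem_GtpYdd_of_level_two_eq` is §2; the reverse inclusion is
the same for `Γ⁻¹`. [cite: MochizukiEtTh2009, Thm 1.6 (i) p.24] -/
theorem map_GtpYdd_eq_of_map_deltaTemp_eq_of_levelChar_eight_chi_eq (hp : p = 2)
    (Γ : PiTpχq p i 2 ≃ₜ* PiTpχq p i 2)
    (hΔ : (curveχq p i 2).DeltaTemp.map Γ.toMulEquiv.toMonoidHom = (curveχq p i 2).DeltaTemp)
    (hχ : ∀ σ : GQp p, ZHatLevel.levelChar 8 (chi p (Γ (SemidirectProduct.inr σ)).right) =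
      ZHatLevel.levelChar 8 (chi p σ)) :
    (ThetaSetting.modelχq p i 2 even_two).GtpYdd.map Γ.toMulEquiv.toMonoidHom =
      (ThetaSetting.modelχq p i 2 even_two).GtpYdd := by
  have hlev : ∀ σ : GQp p, ZHatLevel.level 2 (kappaP p σ ^ i) =
      ZHatLevel.level 2 (kappaP p (Γ (SemidirectProduct.inr σ)).right ^ i) := fun σ => by
    rw [map_zpow, map_zpow, level_two_kappaP_eq_of_levelChar_eight_chi_eq p hp (hχ σ).symm]
  have hlev' : ∀ σ : GQp p, ZHatLevel.level 2 (kappaP p σ ^ i) =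
      ZHatLevel.level 2 (kappaP p (Γ.symm (SemidirectProduct.inr σ)).right ^ i) := fun σ => by
    rw [map_zpow, map_zpow, level_two_kappaP_eq_of_levelChar_eight_chi_eq p hp
      (levelChar_chi_right_symm_apply_inr_eq p i Γ hΔ hχ σ).symm]
  refine le_antisymm ?_ ?_
  · rintro _ ⟨g, hg, rfl⟩
    exact apply_mem_GtpYdd_of_level_two_eq p i Γ hΔ hlev hg
  · intro g hg
    exact ⟨Γ.symm g, apply_mem_GtpYdd_of_level_two_eq p i Γ.symm (map_deltaTempχq_symm_eq p i Γ hΔ) hlev' hg,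
      Γ.apply_symm_apply g⟩

/-- **`p = 2`, hypothesis shape `χ ∘ ν = χ`** (FILE B of the row): Thm. 1.6 (i) at `modelχq 2 i 2` for every
`Δ^tp_X`-stabilising `Γ` over a `χ`-compatible automorphism of `G_{ℚ_2}`, every `i`. [cite: MochizukiEtTh2009, Thm 1.6 (i) p.24] -/
theorem map_GtpYdd_eq_of_map_deltaTemp_eq_of_chi_comp_eq_of_eq_two (hp : p = 2)
    (Γ : PiTpχq p i 2 ≃ₜ* PiTpχq p i 2)
    (hΔ : (curveχq p i 2).DeltaTemp.map Γ.toMulEquiv.toMonoidHom = (curveχq p i 2).DeltaTemp)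
    (hχ : ∀ σ : GQp p, chi p (Γ (SemidirectProduct.inr σ)).right = chi p σ) :
    (ThetaSetting.modelχq p i 2 even_two).GtpYdd.map Γ.toMulEquiv.toMonoidHom =
      (ThetaSetting.modelχq p i 2 even_two).GtpYdd :=
  map_GtpYdd_eq_of_map_deltaTemp_eq_of_levelChar_eight_chi_eq p i hp Γ hΔ fun σ => by rw [hχ σ]

/-- **`p = 2`, ODD `i`: the `b`-exponent of `Γ(a)` is EVEN** for every `Δ^tp_X`-stabilising `Γ` over a `χ₈`-compatible
automorphism of `G_{ℚ_2}` — the answer NO, at `p = 2`, to item (iii) of abc-iut-L6-d6's memo («does a `Δ`-stabilising `Γ`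
with odd parity exist?») for `χ`-compatible `ν` (`2 ≢ 1 (mod 4)` supplies `τ₀` with `χ₄(τ₀) ≠ 1`).
[cite: MochizukiEtTh2009, Thm 1.6 (i) p.24] -/
theorem levelHom_two_y_eq_zero_of_map_deltaTemp_eq_of_levelChar_eight_chi_eq (hp : p = 2) (hi : Odd i)
    (Γ : PiTpχq p i 2 ≃ₜ* PiTpχq p i 2)
    (hΔ : (curveχq p i 2).DeltaTemp.map Γ.toMulEquiv.toMonoidHom = (curveχq p i 2).DeltaTemp)
    (hχ : ∀ σ : GQp p, ZHatLevel.levelChar 8 (chi p (Γ (SemidirectProduct.inr σ)).right) =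
      ZHatLevel.levelChar 8 (chi p σ)) :
    (levelHom 2 (Γ (SemidirectProduct.inl (gfpOf (FreeGroup.of 0)))).left).y = 0 := by
  have hp4 : p % 4 ≠ 1 := by subst hp; decide
  exact levelHom_two_y_eq_zero_of_map_GtpYdd_le p i hi (exists_levelChar_four_chi_ne_one_of_mod_four_ne_one p hp4)
    Γ hΔ (map_GtpYdd_eq_of_map_deltaTemp_eq_of_levelChar_eight_chi_eq p i hp Γ hΔ hχ).le

/-! ## §4. F-0620 `Cor218_i` at `modelχq 2 i 2` from `hextΔ` and the `χ`-compatibility of the extensions -/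

/-- **F-0620 `Cor218_i` at `modelχq 2 i 2`, for every étale-theta datum `E`, every `X̲̲`-choice `C`, every level `μ`,
`hC`, `hS`, `h15` and the EMPTY cusp labelling, FROM `hextΔ` + the `χ`-COMPATIBILITY of `Δ^tp_X`-stabilising
automorphisms of `Π^tp_X`** (the latter is FILE B of the row; with it this is «F-0620 @ modelχq 2 i 2 ⟸ hextΔ alone»,
every `i`). The three `L`-free core clauses are abc-iut-L2-d1's `rigidData_cor218_i_of_extends`, the `Ÿ̲̲`-clause is §3,
labels are empty. CONDITIONAL-AT-MODEL: F-0620@instance is NOT decided. [cite: MochizukiEtTh2009, Cor 2.18(i) p.60] -/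
theorem rigidData_cor218_i_modelχq_of_extends_of_chi_comp_eq_of_eq_two (hp : p = 2)
    (hχΓ : ∀ Γ : PiTpχq p i 2 ≃ₜ* PiTpχq p i 2,
      (curveχq p i 2).DeltaTemp.map Γ.toMulEquiv.toMonoidHom = (curveχq p i 2).DeltaTemp →
        ∀ σ : GQp p, chi p (Γ (SemidirectProduct.inr σ)).right = chi p σ)
    {E : (ThetaSetting.modelχq p i 2 even_two).EtaleThetaData} {l : ℕ} (C : E.DoubleUnderline l) {N : ℕ+}
    (μ : (ThetaSetting.modelχq p i 2 even_two).CyclotomeMod l N) (hC : (ThetaSetting.modelχq p i 2 even_two).Compat)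
    (hS : (ThetaSetting.modelχq p i 2 even_two).Sec2Hyps) (h15 : ThetaSetting.Prop15iii E hC)
    (hext : ∀ γ : ↥C.Huu ≃ₜ* ↥C.Huu, ∃ Γ : PiTpχq p i 2 ≃ₜ* PiTpχq p i 2,
      (∀ h : C.Huu, Γ (h : PiTpχq p i 2) = ((γ h : C.Huu) : PiTpχq p i 2)) ∧
        (curveχq p i 2).DeltaTemp.map Γ.toMulEquiv.toMonoidHom = (curveχq p i 2).DeltaTemp) :
    (C.rigidData μ hC hS h15 ⟨fun _ => ∅, fun _ => ∅, fun _ => rfl⟩).Cor218_i := by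
  refine C.rigidData_cor218_i_of_extends μ hC hS h15 _ (fun γ => ?_) (fun γ a => Set.image_empty _)
  obtain ⟨Γ, hΓ, hΔ⟩ := hext γ
  exact ⟨Γ, hΓ, hΔ, map_GtpYdd_eq_of_map_deltaTemp_eq_of_chi_comp_eq_of_eq_two p i hp Γ hΔ (hχΓ Γ hΔ)⟩

end SettingModel

end Literature.AnabelianGeometry.EtaleTheta

end
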